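import Mathlib

/-!
# Solo-blind seat (MatrixMultiplication), s71 — the line identity for affine-quadratic maps over `𝔽₃` (paper/KraftK3.md §7.12, Remark K3.12.11)

For a quadratic map `Q : M → N` of `𝔽₃`-modules, a linear map `ℓ` and a constant `κ`, the affine-quadratic function `F = Q + ℓ + κ`
satisfies on every affine line `{u, u + d, u - d}` the LINE IDENTITY `F (u + d) + F (u - d) + F u = - Q d` (`lineSum_eq_neg`).
Consequences recorded here (the bookkeeping behind the 'axis-line network' obstructions N1/N2 of §7.12): a level set `{F = c}` meets a
line with `Q d ≠ 0` in at most two points (`not_three_on_line`, the cap property of level sets of anisotropic maps in one line); two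
lines through a common junction whose four other points lie in `{F = c}` have `Q d₁ = Q d₂` (`rhombus_relation`, obstruction N1); and a
chain of three lines whose five non-junction points lie in `{F = c}` forces `Q d₁ + Q d₃ = Q d₂` (`chain3_relation`, obstruction N2 /
the 3-chain network).  Pure algebra over `ZMod 3`; no `ω` content.
-/

set_option linter.dupNamespace false
set_option autoImplicit false

namespace Summit.MatrixMultiplication.MatrixMultiplication.Theorems

/-- The parallelogram law for a (vector-valued) quadratic map: `Q (x + y) + Q (x - y) = 2 • (Q x + Q y)`. -/
theorem quadraticMap_parallelogram {R M N : Type*} [CommRing R] [AddCommGroup M] [Module R M] [AddCommGroup N] [Module R N]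
    (Q : QuadraticMap R M N) (x y : M) : Q (x + y) + Q (x - y) = 2 • (Q x + Q y) := by
  rw [QuadraticMap.map_add Q x y, sub_eq_add_neg, QuadraticMap.map_add Q x (-y), QuadraticMap.map_neg,
    QuadraticMap.polar_neg_right, two_smul]
  abel

/-- In a `ZMod 3`-module, `z + z + z = 0`. -/
theorem add_self_add_self_eq_zero_zmod3 {N : Type*} [AddCommGroup N] [Module (ZMod 3) N] (z : N) : z + z + z = 0 := by
  have h : ((1 : ZMod 3) + 1 + 1) • z = 0 := by
    rw [show ((1 : ZMod 3) + 1 + 1) = 0 by decide, zero_smul]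
  simpa [add_smul] using h

/-- In a `ZMod 3`-module, `2 • z = - z`. -/
theorem two_smul_eq_neg_zmod3 {N : Type*} [AddCommGroup N] [Module (ZMod 3) N] (z : N) : (2 : ℕ) • z = -z := by
  rw [two_smul, ← add_zero (z + z), ← neg_add_cancel z, ← add_assoc, add_comm (z + z) (-z), add_assoc, add_assoc,
    ← add_assoc z z z, add_self_add_self_eq_zero_zmod3, add_zero]

variable {M N : Type*} [AddCommGroup M] [Module (ZMod 3) M] [AddCommGroup N] [Module (ZMod 3) N]

/-- THE LINE IDENTITY (K3.12.11): for `F = Q + ℓ + κ` over `𝔽₃` and any `u d`, `F (u + d) + F (u - d) + F u = - Q d`. -/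
theorem lineSum_eq_neg (Q : QuadraticMap (ZMod 3) M N) (ℓ : M →ₗ[ZMod 3] N) (κ : N) (F : M → N)
    (hF : ∀ x, F x = Q x + ℓ x + κ) (u d : M) : F (u + d) + F (u - d) + F u = -Q d := by
  have hq : Q (u + d) + Q (u - d) = -(Q u + Q d) := by
    rw [quadraticMap_parallelogram, two_smul_eq_neg_zmod3]
  rw [hF, hF, hF, ℓ.map_add, ℓ.map_sub]
  have e1 := add_self_add_self_eq_zero_zmod3 (ℓ u)
  have e2 := add_self_add_self_eq_zero_zmod3 κ
  calc Q (u + d) + (ℓ u + ℓ d) + κ + (Q (u - d) + (ℓ u - ℓ d) + κ) + (Q u + ℓ u + κ)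
      = (Q (u + d) + Q (u - d)) + Q u + (ℓ u + ℓ u + ℓ u) + (κ + κ + κ) := by abel
    _ = -Q d := by rw [hq, e1, e2]; abel

/-- CAP PROPERTY in one line: if `Q d ≠ 0`, a level set `{F = c}` of `F = Q + ℓ + κ` does not contain the whole line `{u, u + d, u - d}`. -/
theorem not_three_on_line (Q : QuadraticMap (ZMod 3) M N) (ℓ : M →ₗ[ZMod 3] N) (κ : N) (F : M → N)
    (hF : ∀ x, F x = Q x + ℓ x + κ) (u d : M) (c : N) (hd : Q d ≠ 0)
    (h1 : F (u + d) = c) (h2 : F (u - d) = c) : F u ≠ c := by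
  intro h3
  have h := lineSum_eq_neg Q ℓ κ F hF u d
  rw [h1, h2, h3, add_self_add_self_eq_zero_zmod3] at h
  exact hd (neg_eq_zero.mp h.symm)

/-- RHOMBUS RELATION (obstruction N1 of §7.12): if the four points `p ± d₁`, `p ± d₂` of two lines through the junction `p` lie in the
level set `{F = c}`, then `Q d₁ = Q d₂`. -/
theorem rhombus_relation (Q : QuadraticMap (ZMod 3) M N) (ℓ : M →ₗ[ZMod 3] N) (κ : N) (F : M → N)
    (hF : ∀ x, F x = Q x + ℓ x + κ) (p d₁ d₂ : M) (c : N)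
    (h1 : F (p + d₁) = c) (h2 : F (p - d₁) = c) (h3 : F (p + d₂) = c) (h4 : F (p - d₂) = c) : Q d₁ = Q d₂ := by
  have e1 := lineSum_eq_neg Q ℓ κ F hF p d₁
  have e2 := lineSum_eq_neg Q ℓ κ F hF p d₂
  rw [h1, h2] at e1
  rw [h3, h4] at e2
  have : -Q d₁ = -Q d₂ := by rw [← e1, ← e2]
  exact neg_injective this

/-- 3-CHAIN RELATION (obstruction N2 / the 3-chain network of §7.12): three lines `L₁ = {p - d₁, p, p + d₁}`, `L₂ = {p, p + d₂, p - d₂}`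
(junctions `p` and `p' = p + d₂`), `L₃ = {p' - d₃, p', p' + d₃}`; if the five non-junction points `p ± d₁`, `p - d₂`, `p' ± d₃` lie in
`{F = c}`, then `Q d₁ + Q d₃ = Q d₂`. -/
theorem chain3_relation (Q : QuadraticMap (ZMod 3) M N) (ℓ : M →ₗ[ZMod 3] N) (κ : N) (F : M → N)
    (hF : ∀ x, F x = Q x + ℓ x + κ) (p d₁ d₂ d₃ : M) (c : N)
    (h1 : F (p + d₁) = c) (h2 : F (p - d₁) = c) (h3 : F (p - d₂) = c)
    (h4 : F (p + d₂ + d₃) = c) (h5 : F (p + d₂ - d₃) = c) : Q d₁ + Q d₃ = Q d₂ := by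
  have e1 := lineSum_eq_neg Q ℓ κ F hF p d₁            -- c + c + F p = -Q d₁
  have e2 := lineSum_eq_neg Q ℓ κ F hF p d₂            -- F (p + d₂) + c + F p = -Q d₂
  have e3 := lineSum_eq_neg Q ℓ κ F hF (p + d₂) d₃     -- c + c + F (p + d₂) = -Q d₃
  rw [h1, h2] at e1
  rw [h3] at e2
  rw [h4, h5] at e3
  have hc := add_self_add_self_eq_zero_zmod3 c
  have key : (c + c + F p) + (c + c + F (p + d₂)) - (F (p + d₂) + c + F p) = c + c + c := by abel
  rw [e1, e3, e2, hc] at key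
  -- key : -Q d₁ + -Q d₃ - -Q d₂ = 0
  have k2 : -Q d₁ + -Q d₃ - -Q d₂ + (Q d₁ + Q d₃) = Q d₂ := by abel
  rw [key, zero_add] at k2
  exact k2

end Summit.MatrixMultiplication.MatrixMultiplication.Theorems
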